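import Literature.IUT.HodgeTheaters.Cor53InjectiveOfMonoidRigidity
import Literature.AnabelianGeometry.EtaleTheta.TemperedFrobenioidModel
import HarnessLib

/-!
# [IUTchI] Cor 5.3 (iv) AT an [EtTh] Def 3.6 tempered Frobenioid: «`Aut(ℱ̲_v) → Aut(𝒟_v)` injective» modulo ONE law
# (proof-only instance of `Cor53InjectiveOfMonoidRigidity` at abc-iut-L2-t3's `TemperedFrobenioid.category`)

S. Mochizuki, *Inter-universal Teichmüller theory I*, kurims manuscript (May 2020), §5 Corollary 5.3 (iv) p. 144
l. 24–30: «Let `v ∈ 𝕍^bad`. Recall the category `ℱ̲_v` of Example 3.2, (i). Thus, `ℱ̲_v` is equipped with a natural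
Frobenioid structure [cf. [FrdI], Corollary 4.11; [EtTh], Proposition 5.1], with base category `𝒟_v`. Then the natural
homomorphism `Aut(ℱ̲_v) → Aut(𝒟_v)` [cf. Example 3.2, (vi), (d)] is bijective»; proof p. 144 l. 41 – p. 145 l. 38
([IUTchI] Cor 5.3 (iv) p.144) [claim: Mochizuki2012, status: disputed] (D-0012 claim key; nothing of the series is
asserted; no side taken on [IUTchIII] Cor. 3.12).  S. Mochizuki, *The étale theta function …*, Def 3.6 (ii) p. 77
(PRIMS p. 303): «the data `(D, Φ, B, B → Φ^gp)` determines a model Frobenioid `C`» [cite: MochizukiEtTh2009, Def 3.6 p.77]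
— abc-iut-L2-t3's `TemperedFrobenioid.category C := ModelFrobenioid C.divisorMonoid C.ratFnFunctor C.divBNatTrans`
over its base `D` (`baseFunctorOfCategory`), `TemperedFrobenioidModel.lean`.

PROOF-ONLY (theorems only): cone node `IUTchI:Cor5.3(iv)`, plan/L5 `SUBDAG-IUTchI-Cor53.md` §D; typer of record
abc-iut-L5-t4.  The CARRIER of Cor 5.3 (iv) in the tree is every [EtTh] Def 3.6 tempered Frobenioid (abc-iut-L5-t2's
genuine bad-place files quantify over «every tempered Frobenioid `Fr` on the genuine `D_v̲`», p489650); since its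
category IS an L1 model Frobenioid, abc-iut-L5-t4's knit `Cor53.descend_injective_model_of_monoidRigid` (p493191;
§0 `descend` × abc-iut-L1-t7's S2 p491743 × abc-iut-L1-t14's Cor 4.11 at the model p491530 × abc-iut-L6-t7 p492904)
instantiates verbatim:

* `Cor53.tempered_descend_injective_of_monoidRigid` — for EVERY tempered Frobenioid `C` over `D`, the
  natural map `Aut(C.category) → Aut(D)` of §0 (`CatIsomorphism.descend`, binders from [FrdI] Cor 4.11 (ii)) is
  INJECTIVE modulo the six [FrdI] standing hypotheses BY NAME (Thm 5.2 `Hypotheses`; `Φ` perf-factorial,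
  non-dilating, non-zero; `D` slim, FSMFF — [EtTh] Thm 3.7 / [FrdI] Thm 5.2 (iii) content at `C`, abc-iut-L2's to
  discharge) and the ONE LAW hmon «every self-equivalence over the identity of `D` induces the identity on `Φ` and
  `B`» (print p. 145 l. 1–2 = steps S3∧S4∧S5: cyclotomic rigidity [EtTh] Thm 5.6/Prop 5.5, Kummer naturality
  [FrdII] Def 2.1 (ii), injectivity [EtTh] Prop 3.2 (iii), cuspidal/non-cuspidal [EtTh] Prop 5.3, torsion
  divisors p408577 — L2 content, NOT proved here);
* `Cor53.tempered_descendBijective_of_monoidRigid_of_lifts` — BIJECTIVE (print's statement) modulo hmon and the lifting half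
  hlift (print p. 144 l. 41–43, [AbsTopIII] Thm 1.9 / Rmk 1.9.1 — FACT-policy, BY NAME).
Binder census of the headline: LAW 1 (hmon) · FACT 0 (1 for the bijective form: hlift) · by-name standing
hypotheses 6 · DATA `C : TemperedFrobenioid T D VD`.  Typed ≠ proved for hmon/hlift; no token flip claimed.
-/

namespace Literature.IUT.HodgeTheaters

open CategoryTheory Opposite Literature.AlgebraicGeometry.Frobenioids Literature.AnabelianGeometry.EtaleTheta

universe u₀ v₀ u v w

namespace Cor53

variable {D₀ : Type u₀} [Category.{v₀} D₀] {V : FrdIMonoidStub.{w}}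
  {T : RealifiedDivisorMonoids (D₀ := D₀) V} {D : Type u} [Category.{v} D]
  {VD : FrdICatStub.{u, v, w} D} (C : TemperedFrobenioid T D VD)

/-- **[IUTchI] Cor 5.3 (iv), injectivity half, AT every [EtTh] Def 3.6 tempered Frobenioid** `C` over `D`:
«the natural homomorphism `Aut(ℱ̲_v) → Aut(𝒟_v)`» — the §0 map `CatIsomorphism.descend` for
`C.category = ModelFrobenioid Φ B Div_B` over `C.baseFunctorOfCategory`, binders from [FrdI] Cor 4.11 (ii) —
is INJECTIVE modulo the six [FrdI] standing hypotheses BY NAME and the ONE LAW `hmon` («`α` induces the identity on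
the rational function and divisor monoids of `ℱ̲_v`», p. 145 l. 1–2).  Instance of abc-iut-L5-t4's
`Cor53.descend_injective_model_of_monoidRigid`. ([IUTchI] Cor 5.3 (iv) p.144) [claim: Mochizuki2012, status: disputed] -/
theorem tempered_descend_injective_of_monoidRigid
    (h : ModelFrobenioid.Hypotheses C.divisorMonoid C.ratFnFunctor)
    (hpf : Objectwise (fun M _ => IsPerfFactorial M) C.divisorMonoid) (hsl : IsSlim D) (hfs : IsOfFSMFFType D)
    (hnd : IsNonDilatingOn C.divisorMonoid) (hz : ¬ ModelFrobenioid.IsZeroMonoid C.divisorMonoid)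
    (hmon : ∀ Ψ : C.category ≌ C.category,
      Nonempty (Ψ.functor ⋙ C.baseFunctorOfCategory ≅ C.baseFunctorOfCategory) →
      ∃ η : Ψ.functor ⋙ C.baseFunctorOfCategory ≅ C.baseFunctorOfCategory,
        (∀ ⦃X Y : C.category⦄ (φ : X ⟶ Y),
            ModelFrobenioid.div (Ψ.functor.map φ) =
              pull C.divisorMonoid (η.hom.app X : (Ψ.functor.obj X).base ⟶ X.base) (ModelFrobenioid.div φ)) ∧
        (∀ ⦃X Y : C.category⦄ (φ : X ⟶ Y),
            ModelFrobenioid.unit (Ψ.functor.map φ) =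
              pull C.ratFnFunctor (η.hom.app X : (Ψ.functor.obj X).base ⟶ X.base) (ModelFrobenioid.unit φ))) :
    Function.Injective
      (CatIsomorphism.descend
        (Cor53.hasUnder_baseFunctor_model (DivB := C.divBNatTrans) h hpf hsl hfs hnd hz)
        (Cor53.underUnique_baseFunctor_model (DivB := C.divBNatTrans) h hpf hsl hfs hnd hz)) :=
  Cor53.descend_injective_model_of_monoidRigid (DivB := C.divBNatTrans) h hpf hsl hfs hnd hz hmon

/-- **[IUTchI] Cor 5.3 (iv) AS PRINTED («is bijective») AT every [EtTh] Def 3.6 tempered Frobenioid**, modulo the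
LAW `hmon` (injectivity content, steps S3–S5) and the lifting hypothesis `hlift` (surjectivity: «automorphisms of
`𝒟_v = ℬ^temp(X̲̲_v)⁰` necessarily arise from automorphisms of the scheme `X̲̲_v` [[AbsTopIII] Thm 1.9] ⇒ surjectivity
follows immediately from the construction of `ℱ̲_v`», p. 144 l. 41–43 — FACT-policy, BY NAME) and the six [FrdI]
standing hypotheses: `CatIsomorphism.DescendBijective` holds. ([IUTchI] Cor 5.3 (iv) p.144) [claim: Mochizuki2012, status: disputed] -/
theorem tempered_descendBijective_of_monoidRigid_of_lifts
    (h : ModelFrobenioid.Hypotheses C.divisorMonoid C.ratFnFunctor)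
    (hpf : Objectwise (fun M _ => IsPerfFactorial M) C.divisorMonoid) (hsl : IsSlim D) (hfs : IsOfFSMFFType D)
    (hnd : IsNonDilatingOn C.divisorMonoid) (hz : ¬ ModelFrobenioid.IsZeroMonoid C.divisorMonoid)
    (hmon : ∀ Ψ : C.category ≌ C.category,
      Nonempty (Ψ.functor ⋙ C.baseFunctorOfCategory ≅ C.baseFunctorOfCategory) →
      ∃ η : Ψ.functor ⋙ C.baseFunctorOfCategory ≅ C.baseFunctorOfCategory,
        (∀ ⦃X Y : C.category⦄ (φ : X ⟶ Y),
            ModelFrobenioid.div (Ψ.functor.map φ) =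
              pull C.divisorMonoid (η.hom.app X : (Ψ.functor.obj X).base ⟶ X.base) (ModelFrobenioid.div φ)) ∧
        (∀ ⦃X Y : C.category⦄ (φ : X ⟶ Y),
            ModelFrobenioid.unit (Ψ.functor.map φ) =
              pull C.ratFnFunctor (η.hom.app X : (Ψ.functor.obj X).base ⟶ X.base) (ModelFrobenioid.unit φ)))
    (hlift : ∀ Θ : D ≌ D, ∃ Ψ : C.category ≌ C.category,
      Nonempty (CatIsomorphism.LiesUnder C.baseFunctorOfCategory C.baseFunctorOfCategory Ψ Θ)) :
    CatIsomorphism.DescendBijective C.baseFunctorOfCategory C.baseFunctorOfCategory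
      (Cor53.hasUnder_baseFunctor_model (DivB := C.divBNatTrans) h hpf hsl hfs hnd hz)
      (Cor53.underUnique_baseFunctor_model (DivB := C.divBNatTrans) h hpf hsl hfs hnd hz) :=
  ⟨tempered_descend_injective_of_monoidRigid C h hpf hsl hfs hnd hz hmon,
    CatIsomorphism.descend_surjective_of_lifts _ _ hlift⟩

/-- The same in «natural homomorphism» form: `CatIsomorphism.descendHom : Aut(C.category) →* Aut(D)` is injective
modulo hmon and the standing hypotheses. ([IUTchI] Cor 5.3 (iv) p.144) [claim: Mochizuki2012, status: disputed] -/
theorem tempered_descendHom_injective_of_monoidRigid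
    (h : ModelFrobenioid.Hypotheses C.divisorMonoid C.ratFnFunctor)
    (hpf : Objectwise (fun M _ => IsPerfFactorial M) C.divisorMonoid) (hsl : IsSlim D) (hfs : IsOfFSMFFType D)
    (hnd : IsNonDilatingOn C.divisorMonoid) (hz : ¬ ModelFrobenioid.IsZeroMonoid C.divisorMonoid)
    (hmon : ∀ Ψ : C.category ≌ C.category,
      Nonempty (Ψ.functor ⋙ C.baseFunctorOfCategory ≅ C.baseFunctorOfCategory) →
      ∃ η : Ψ.functor ⋙ C.baseFunctorOfCategory ≅ C.baseFunctorOfCategory,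
        (∀ ⦃X Y : C.category⦄ (φ : X ⟶ Y),
            ModelFrobenioid.div (Ψ.functor.map φ) =
              pull C.divisorMonoid (η.hom.app X : (Ψ.functor.obj X).base ⟶ X.base) (ModelFrobenioid.div φ)) ∧
        (∀ ⦃X Y : C.category⦄ (φ : X ⟶ Y),
            ModelFrobenioid.unit (Ψ.functor.map φ) =
              pull C.ratFnFunctor (η.hom.app X : (Ψ.functor.obj X).base ⟶ X.base) (ModelFrobenioid.unit φ))) :
    Function.Injective
      (CatIsomorphism.descendHom
        (Cor53.hasUnder_baseFunctor_model (DivB := C.divBNatTrans) h hpf hsl hfs hnd hz)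
        (Cor53.underUnique_baseFunctor_model (DivB := C.divBNatTrans) h hpf hsl hfs hnd hz)) :=
  tempered_descend_injective_of_monoidRigid C h hpf hsl hfs hnd hz hmon

end Cor53

end Literature.IUT.HodgeTheaters
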